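import Summits.QuantumFields.YangMills.Theorems.PoincareLipschitzSphereMapPoincareL1

/-!
# Line «poincare_lipschitz» on crux `HistoryTailL` (stmt-QuantumFields-19936), route crux `BlockLipschitzL` (stmt-QuantumFields-23533), K2 organ of record LOC-REG-MIN —
# FLAT SHADOW «ENERGY → RANGE» (E→R) FOR LATTICE MINIMISERS INTO A SPHERE, FILE 2c: SHARP NESTED-BOX MEANS — for `Q′ = Q_{σ′}(x′) ⊆ Q = Q_σ(x)` with `σ ≤ σ′ + 1`:
# the EXACT identity `#Q′ • (ū_Q − ū_{Q′}) = Σ_{y ∈ Q ∖ Q′} (u y − ū_Q)`, the THIN-SHELL estimate `Σ_{Q ∖ Q′} ‖u − ū_Q‖ ≤ (2 + 4d)·Σ_Q Σ_μ ‖∂_μ u‖`, and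
# `‖ū_Q − ū_{Q′}‖ ≤ (2 + 4d)·(#Q′)⁻¹·Σ_Q Σ_μ ‖∂_μ u‖` — NO factor `σ` (the letter the variable-radius mollifier needs)

Cell `ym3-torus` (YM ladder rung R3 = continuum SU(2) Yang–Mills on the three-torus — a RUNG, NOT the Clay problem: not d = 4, not infinite volume, not a mass gap); width seat
`ym-ust-19936-w5` gen 12 (LEAD ym-ust-19936-w1 g8 2026-08-29T05:15:34Z «F4 = ★w5's σ + F2 ∘ F4-core; F5 = ★w5's pen»; my LOCATE `E2R-ROAD-w5g12.md` §2 (iv), §3 F2∕F4).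
THEOREMS ONLY (def-free; means written `(#Q)⁻¹ • Σ_Q u`), values in any real normed space `V`, lattice letters of lit ✓`B4Eq19LatticeOperators`; builds on ★w5 g12's
✓`PoincareLipschitzSphereMapPoincareL1` (vector `ℓ¹` Poincaré, `norm_sub_line_sum_le`); `--supports stmt-QuantumFields-19936`.  Nothing here proves E→R, LOC-REG-MIN, `hReg`, a
stub, `BlockLipschitzL`, `HistoryTailL` or a summit statement; nothing twisted ∕ covariant is in this file.

WHY (`E2R-ROAD-w5g12.md` §2 (iv)): the layer competitor is `x ↦ π(ū_{σ(x)}(x))` with `σ(x) = ⌊θ·depth(x)⌋`, so along a bond the radius changes by at most one and the centre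
by one: `box x σ ⊆ box (x+e_μ) (σ+1)`, `box (x+e_μ) (σ−1) ⊆ box x σ`.  The per-bond energy of the competitor must be `≲` the LOCAL AVERAGE of `‖∇u‖²` with NO factor `σ²`
(a `σ²`-lossy bound — Jensen on nested means, ✓`normSq_mean_sub_mean_le_of_subset` ∘ Poincaré — inflates the layer budget by `r²`, checked on paper); the sharp bound comes from
the exact identity of §1 (only the THIN SHELL `Q ∖ Q′` enters) and the line argument of §3 (each shell point is extreme in some coordinate `ν`; on its `ν`-line through `Q` the
deviation from `ū_Q` costs one line variation plus the line's share of `Σ_Q‖u − ū_Q‖`, and at most TWO abscissae per line are extreme).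
* §1 ★ `card_smul_mean_sub_mean_eq` (EXACT: `#Q′ • (ū_Q − ū_{Q′}) = Σ_{Q∖Q′}(u − ū_Q)`, any finsets `Q′ ⊆ Q`), ★ `norm_mean_sub_mean_le_sum_sdiff`
  (`‖ū_Q − ū_{Q′}‖ ≤ (#Q′)⁻¹·Σ_{Q∖Q′}‖u − ū_Q‖`);
* §2 `Icc_subset_Icc_of_box_subset` (coordinate intervals of nested boxes are nested), `card_Icc_sdiff_le_two` (`σ ≤ σ′ + 1` ⟹ at most two extreme abscissae),
  `exists_coord_not_mem_Icc` (a point of `Q ∖ Q′` is extreme in some coordinate);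
* §3 `norm_sub_mean_le_line` (one point against the box mean through its `ν`-line), `sum_pinned_line_eq` (re-assembling pinned line sums into box sums),
  ★★ `sum_sdiff_norm_sub_mean_le` (THIN SHELL: `Σ_{Q∖Q′}‖u − ū_Q‖ ≤ (2 + 4d)·Σ_QΣ_μ‖u(y+e_μ) − u y‖`);
* §4 ★★★ `norm_mean_sub_mean_le_of_nested` (`‖ū_Q − ū_{Q′}‖ ≤ (2 + 4d)·(#Q′)⁻¹·Σ_QΣ_μ‖∂_μu‖`), `sq_sum_sum_norm_le` (`(ΣΣ‖g‖)² ≤ d·#Q·ΣΣ‖g‖²`),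
  ★★ `normSq_mean_sub_mean_le_of_nested` (`‖ū_Q − ū_{Q′}‖² ≤ (2 + 4d)²·d·#Q·(#Q′)⁻²·Σ_QΣ_μ‖∂_μu‖²` — with `#Q ≤ 3^d·#Q′` this is `C_d·avg_Q‖∇u‖²`).
[folklore] (the continuum statement is `|dū_r∕dr| ≤ avg_{B_r}|∇u|`, [SchoenUhlenbeck1982] §4's mollifier with variable radius; [Giaquinta1984] Ch. III §1; the lattice
statements are this file's).
-/

set_option autoImplicit false

noncomputable section

open scoped BigOperators
open Finset

namespace Summit.QuantumFields.YangMills.Theorems.PoincareLipschitzSphereMapNestedMeans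

open Literature.MathematicalPhysics.QuantumFieldTheory.Balaban1983to89
open B4Eq19LatticeOperators
open B4Eq19LatticePoincareMorrey (update_mem_box)
open Summit.QuantumFields.YangMills.Theorems.PoincareLipschitzSphereMapPoincareL1 (norm_sub_line_sum_le sum_norm_sub_mean_le)

variable {d : ℕ} {V : Type*} [NormedAddCommGroup V] [NormedSpace ℝ V]

/-! ## §1 The exact identity for nested means -/

/-- ★ **EXACT**: for finsets `Q′ ⊆ Q`, `Q` nonempty: `#Q′ • (ū_Q − ū_{Q′}) = Σ_{y ∈ Q ∖ Q′} (u y − ū_Q)` (`ū_S = (#S)⁻¹ • Σ_S u`; for `Q′ = ∅` both sides are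
`Σ_Q (u − ū_Q) = 0`). [folklore] -/
theorem card_smul_mean_sub_mean_eq {α : Type*} [DecidableEq α] {Q Q' : Finset α} (hsub : Q' ⊆ Q) (hQ : Q.Nonempty) (u : α → V) :
    (Q'.card : ℝ) • (((Q.card : ℝ))⁻¹ • ∑ y ∈ Q, u y - ((Q'.card : ℝ))⁻¹ • ∑ y ∈ Q', u y) =
      ∑ y ∈ Q \ Q', (u y - ((Q.card : ℝ))⁻¹ • ∑ y' ∈ Q, u y') := by
  set m : V := ((Q.card : ℝ))⁻¹ • ∑ y' ∈ Q, u y' with hm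
  have hQc : (Q.card : ℝ) ≠ 0 := by exact_mod_cast hQ.card_pos.ne'
  have hsumQ : ∑ y ∈ Q, u y = (Q.card : ℝ) • m := by
    rw [hm, smul_smul, mul_inv_cancel₀ hQc, one_smul]
  -- `#Q′ • ((#Q′)⁻¹ • Σ_{Q′} u) = Σ_{Q′} u` (also when `Q′ = ∅`, both sides being `0`)
  have hS' : (Q'.card : ℝ) • (((Q'.card : ℝ))⁻¹ • ∑ y ∈ Q', u y) = ∑ y ∈ Q', u y := by
    by_cases hQ' : Q'.card = 0
    · have hQ'e : Q' = ∅ := Finset.card_eq_zero.1 hQ'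
      rw [hQ'e]; simp
    · have hQ'c : (Q'.card : ℝ) ≠ 0 := by exact_mod_cast hQ'
      rw [smul_smul, mul_inv_cancel₀ hQ'c, one_smul]
  have hsd : ∑ y ∈ Q \ Q', u y = ∑ y ∈ Q, u y - ∑ y ∈ Q', u y := by
    rw [eq_sub_iff_add_eq, Finset.sum_sdiff hsub]
  have hcard : (((Q \ Q').card : ℕ) : ℝ) = Q.card - Q'.card := by
    rw [Finset.card_sdiff_of_subset hsub, Nat.cast_sub (Finset.card_le_card hsub)]
  have hR : ∑ y ∈ Q \ Q', (u y - m) = ∑ y ∈ Q \ Q', u y - (((Q \ Q').card : ℕ) : ℝ) • m := by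
    rw [Finset.sum_sub_distrib, Finset.sum_const, Nat.cast_smul_eq_nsmul]
  rw [hR, hcard, hsd, hsumQ, smul_sub, hS', sub_smul]
  abel

/-- ★ **`‖ū_Q − ū_{Q′}‖ ≤ (#Q′)⁻¹ · Σ_{y ∈ Q ∖ Q′} ‖u y − ū_Q‖`** for finsets `Q′ ⊆ Q`, `Q′` nonempty. [folklore] -/
theorem norm_mean_sub_mean_le_sum_sdiff {α : Type*} [DecidableEq α] {Q Q' : Finset α} (hsub : Q' ⊆ Q) (hQ' : Q'.Nonempty) (u : α → V) :
    ‖((Q.card : ℝ))⁻¹ • ∑ y ∈ Q, u y - ((Q'.card : ℝ))⁻¹ • ∑ y ∈ Q', u y‖ ≤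
      ((Q'.card : ℝ))⁻¹ * ∑ y ∈ Q \ Q', ‖u y - ((Q.card : ℝ))⁻¹ • ∑ y' ∈ Q, u y'‖ := by
  have hQ : Q.Nonempty := hQ'.mono hsub
  have hc : (0 : ℝ) < Q'.card := by exact_mod_cast hQ'.card_pos
  have h := card_smul_mean_sub_mean_eq hsub hQ u
  have h1 : (Q'.card : ℝ) * ‖((Q.card : ℝ))⁻¹ • ∑ y ∈ Q, u y - ((Q'.card : ℝ))⁻¹ • ∑ y ∈ Q', u y‖ ≤
      ∑ y ∈ Q \ Q', ‖u y - ((Q.card : ℝ))⁻¹ • ∑ y' ∈ Q, u y'‖ := by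
    have e : (Q'.card : ℝ) * ‖((Q.card : ℝ))⁻¹ • ∑ y ∈ Q, u y - ((Q'.card : ℝ))⁻¹ • ∑ y ∈ Q', u y‖ =
        ‖(Q'.card : ℝ) • (((Q.card : ℝ))⁻¹ • ∑ y ∈ Q, u y - ((Q'.card : ℝ))⁻¹ • ∑ y ∈ Q', u y)‖ := by
      rw [norm_smul, Real.norm_eq_abs, abs_of_pos hc]
    rw [e, h]; exact norm_sum_le _ _
  rw [le_inv_mul_iff₀ hc]; exact h1

/-! ## §2 Coordinates of nested boxes -/

/-- Coordinate intervals of nested boxes are nested: `Q_{σ′}(x′) ⊆ Q_σ(x)`, `σ′ ≥ 0` ⟹ `[x′_i − σ′, x′_i + σ′] ⊆ [x_i − σ, x_i + σ]`. [folklore] -/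
theorem Icc_subset_Icc_of_box_subset {x x' : Zd d} {σ σ' : ℤ} (hσ' : 0 ≤ σ') (hsub : box x' σ' ⊆ box x σ) (i : Fin d) :
    Finset.Icc (x' i - σ') (x' i + σ') ⊆ Finset.Icc (x i - σ) (x i + σ) := by
  intro t ht
  have hy : Function.update x' i t ∈ box x σ := hsub (update_mem_box (self_mem_box x' hσ') i ht)
  have h := (mem_box.1 hy) i
  rw [Function.update_self] at h
  rw [Finset.mem_Icc]; rw [abs_le] at h; constructor <;> linarith [h.1, h.2]

/-- At most two extreme abscissae: with the inclusion of §2 and `σ ≤ σ′ + 1`, `#([x_i − σ, x_i + σ] ∖ [x′_i − σ′, x′_i + σ′]) ≤ 2`. [folklore] -/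
theorem card_Icc_sdiff_le_two {x x' : Zd d} {σ σ' : ℤ} (hσ' : 0 ≤ σ') (hsub : box x' σ' ⊆ box x σ) (hσ : σ ≤ σ' + 1) (i : Fin d) :
    (Finset.Icc (x i - σ) (x i + σ) \ Finset.Icc (x' i - σ') (x' i + σ')).card ≤ 2 := by
  have hinc := Icc_subset_Icc_of_box_subset hσ' hsub i
  rw [Finset.card_sdiff_of_subset hinc, Int.card_Icc, Int.card_Icc]
  have h1 : (x i + σ + 1 - (x i - σ)).toNat = (2 * σ + 1).toNat := by ring_nf
  have h2 : (x' i + σ' + 1 - (x' i - σ')).toNat = (2 * σ' + 1).toNat := by ring_nf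
  rw [h1, h2]
  have hσ0 : σ' ≤ σ := by
    have := Finset.card_le_card hinc
    rw [Int.card_Icc, Int.card_Icc, h1, h2] at this
    omega
  omega

/-- A point of `Q ∖ Q′` is extreme in some coordinate: `y ∉ Q_{σ′}(x′)` ⟹ `∃ ν, y_ν ∉ [x′_ν − σ′, x′_ν + σ′]`. [folklore] -/
theorem exists_coord_not_mem_Icc {x' y : Zd d} {σ' : ℤ} (hy : y ∉ box x' σ') :
    ∃ ν : Fin d, y ν ∉ Finset.Icc (x' ν - σ') (x' ν + σ') := by
  by_contra h
  push Not at h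
  apply hy
  rw [mem_box]
  intro i
  have := h i
  rw [Finset.mem_Icc] at this
  rw [abs_le]; constructor <;> linarith [this.1, this.2]

/-! ## §3 The thin-shell estimate -/

omit [NormedSpace ℝ V] in
/-- **One point against the box mean through its line**: for `w ∈ Q_σ(z)` (`σ ≥ 0`), any `m`, and a direction `ν`:
`‖u w − m‖ ≤ Σ_{t ∈ I_ν} ‖u(w[ν:=t] + e_ν) − u(w[ν:=t])‖ + (2σ+1)⁻¹·Σ_{t ∈ I_ν} ‖u(w[ν:=t]) − m‖` (average the triangle inequality over the line, then
✓`norm_sub_line_sum_le`). [folklore] -/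
theorem norm_sub_le_line (u : Zd d → V) (m : V) (z : Zd d) {σ : ℤ} (hσ : 0 ≤ σ) (ν : Fin d) {w : Zd d} (hw : w ∈ box z σ) :
    ‖u w - m‖ ≤ ∑ t ∈ Finset.Icc (z ν - σ) (z ν + σ), ‖u (Function.update w ν t + unitVec ν) - u (Function.update w ν t)‖ +
      (((2 * σ + 1 : ℤ) : ℝ))⁻¹ * ∑ t ∈ Finset.Icc (z ν - σ) (z ν + σ), ‖u (Function.update w ν t) - m‖ := by
  set I := Finset.Icc (z ν - σ) (z ν + σ) with hI
  set n : ℝ := ((2 * σ + 1 : ℤ) : ℝ) with hn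
  have hn0 : 0 < n := by rw [hn]; exact_mod_cast (show (0:ℤ) < 2 * σ + 1 by linarith)
  have hcard : (I.card : ℝ) = n := by
    rw [hI, Int.card_Icc, show z ν + σ + 1 - (z ν - σ) = 2 * σ + 1 by ring, hn]
    rw [← Int.cast_natCast, Int.toNat_of_nonneg (by linarith)]
  -- `n‖u w − m‖ ≤ Σ_t (‖u w − u(w[t])‖ + ‖u(w[t]) − m‖)`
  have h1 : n * ‖u w - m‖ ≤ ∑ t ∈ I, (‖u w - u (Function.update w ν t)‖ + ‖u (Function.update w ν t) - m‖) := by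
    have e : n * ‖u w - m‖ = ∑ _t ∈ I, ‖u w - m‖ := by rw [Finset.sum_const, nsmul_eq_mul, hcard]
    rw [e]
    refine Finset.sum_le_sum fun t _ => ?_
    have := norm_sub_le (u w - u (Function.update w ν t)) (m - u (Function.update w ν t))
    rw [show u w - u (Function.update w ν t) - (m - u (Function.update w ν t)) = u w - m by abel, norm_sub_rev m] at this
    exact this
  have h2 := norm_sub_line_sum_le z hσ ν u hw
  rw [Finset.sum_add_distrib] at h1
  have h3 : n * ‖u w - m‖ ≤ n * ∑ t ∈ I, ‖u (Function.update w ν t + unitVec ν) - u (Function.update w ν t)‖ + ∑ t ∈ I, ‖u (Function.update w ν t) - m‖ :=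
    h1.trans (by linarith)
  have h4 : ‖u w - m‖ ≤ ∑ t ∈ I, ‖u (Function.update w ν t + unitVec ν) - u (Function.update w ν t)‖ + n⁻¹ * ∑ t ∈ I, ‖u (Function.update w ν t) - m‖ := by
    rw [← sub_le_iff_le_add']
    have := (le_div_iff₀' hn0).2 (by linarith : n * (‖u w - m‖ - ∑ t ∈ I, ‖u (Function.update w ν t + unitVec ν) - u (Function.update w ν t)‖) ≤
      ∑ t ∈ I, ‖u (Function.update w ν t) - m‖)
    rw [div_eq_inv_mul] at this
    linarith
  exact h4

/-- **Re-assembling pinned line sums into box sums**: `Σ_{y ∈ P_ν(a)} Σ_{t ∈ I_ν} F(y[ν:=t]) = Σ_{y ∈ Q_σ(z)} F y`, `P_ν(a)` the box with coordinate `ν` pinned to `a`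
(✓`sum_box_eq_sum_update` read backwards). [folklore] -/
theorem sum_pinned_line_eq {α : Type*} [AddCommMonoid α] (z : Zd d) (σ : ℤ) (ν : Fin d) (a : ℤ) (F : Zd d → α) :
    ∑ y ∈ Fintype.piFinset (Function.update (fun i => Finset.Icc (z i - σ) (z i + σ)) ν {a}),
        ∑ t ∈ Finset.Icc (z ν - σ) (z ν + σ), F (Function.update y ν t) = ∑ y ∈ box z σ, F y := by
  rw [sum_box_eq_sum_update (α := α) z σ ν a F, Finset.sum_comm]

/-- ★★ **THE THIN-SHELL ESTIMATE**: `Q′ = Q_{σ′}(x′) ⊆ Q = Q_σ(x)`, `0 ≤ σ, σ′`, `σ ≤ σ′ + 1` ⟹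
`Σ_{y ∈ Q ∖ Q′} ‖u y − ū_Q‖ ≤ (2 + 4d)·Σ_{y ∈ Q} Σ_μ ‖u(y+e_μ) − u(y)‖` (`ū_Q` the mean over `Q`).  Each shell point is extreme in some coordinate `ν`
(`exists_coord_not_mem_Icc`); on its `ν`-line `norm_sub_le_line` costs one line variation plus the line's share of `Σ_Q‖u − ū_Q‖`; at most two abscissae per line are
extreme (`card_Icc_sdiff_le_two`); the shares add up to `(2d∕(2σ+1))·Σ_Q‖u − ū_Q‖ ≤ 4d·Σ_QΣ_μ‖∂u‖` by the mean-form Poincaré inequality ✓`sum_norm_sub_mean_le`.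
[folklore] [cite: Giaquinta1984, Ch. III §1 p.65] -/
theorem sum_sdiff_norm_sub_mean_le (u : Zd d → V) {x x' : Zd d} {σ σ' : ℤ} (hσ0 : 0 ≤ σ) (hσ' : 0 ≤ σ') (hsub : box x' σ' ⊆ box x σ)
    (hσ : σ ≤ σ' + 1) :
    ∑ y ∈ box x σ \ box x' σ', ‖u y - (((box x σ).card : ℝ))⁻¹ • ∑ y' ∈ box x σ, u y'‖ ≤
      (2 + 4 * d) * ∑ y ∈ box x σ, ∑ μ, ‖u (y + unitVec μ) - u y‖ := by
  classical
  set Q := box x σ with hQ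
  set m : V := ((Q.card : ℝ))⁻¹ • ∑ y' ∈ Q, u y' with hm
  set G : ℝ := ∑ y ∈ Q, ∑ μ, ‖u (y + unitVec μ) - u y‖ with hG
  set n : ℝ := ((2 * σ + 1 : ℤ) : ℝ) with hn
  have hn0 : 0 < n := by rw [hn]; exact_mod_cast (show (0:ℤ) < 2 * σ + 1 by linarith)
  set f : Zd d → ℝ := fun y => ‖u y - m‖ with hf
  have hf0 : ∀ y, 0 ≤ f y := fun y => norm_nonneg _
  -- (a) indicator bound on the shell
  have hstep1 : ∑ y ∈ Q \ box x' σ', f y ≤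
      ∑ ν : Fin d, ∑ y ∈ Q, (if y ν ∉ Finset.Icc (x' ν - σ') (x' ν + σ') then f y else 0) := by
    rw [Finset.sum_comm]
    have h1 : ∀ y ∈ Q \ box x' σ', f y ≤ ∑ ν : Fin d, (if y ν ∉ Finset.Icc (x' ν - σ') (x' ν + σ') then f y else 0) := by
      intro y hy
      rw [Finset.mem_sdiff] at hy
      obtain ⟨ν, hν⟩ := exists_coord_not_mem_Icc hy.2
      have h2 : (if y ν ∉ Finset.Icc (x' ν - σ') (x' ν + σ') then f y else 0) ≤
          ∑ ν' : Fin d, (if y ν' ∉ Finset.Icc (x' ν' - σ') (x' ν' + σ') then f y else 0) :=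
        Finset.single_le_sum (f := fun ν' => if y ν' ∉ Finset.Icc (x' ν' - σ') (x' ν' + σ') then f y else 0)
          (fun ν' _ => by split_ifs <;> simp [hf0 y]) (Finset.mem_univ ν)
      rw [if_pos hν] at h2
      exact h2
    calc ∑ y ∈ Q \ box x' σ', f y ≤ ∑ y ∈ Q \ box x' σ', ∑ ν : Fin d, (if y ν ∉ Finset.Icc (x' ν - σ') (x' ν + σ') then f y else 0) :=
          Finset.sum_le_sum h1
      _ ≤ ∑ y ∈ Q, ∑ ν : Fin d, (if y ν ∉ Finset.Icc (x' ν - σ') (x' ν + σ') then f y else 0) :=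
          Finset.sum_le_sum_of_subset_of_nonneg Finset.sdiff_subset fun y _ _ => Finset.sum_nonneg fun ν _ => by split_ifs <;> simp [hf0 y]
  -- (b) one direction: at most two extreme abscissae, each costing a line variation plus the line's share
  have hstep2 : ∀ ν : Fin d, ∑ y ∈ Q, (if y ν ∉ Finset.Icc (x' ν - σ') (x' ν + σ') then f y else 0) ≤
      2 * (∑ y ∈ Q, ‖u (y + unitVec ν) - u y‖ + n⁻¹ * ∑ y ∈ Q, f y) := by
    intro ν
    set I := Finset.Icc (x ν - σ) (x ν + σ) with hI
    set I' := Finset.Icc (x' ν - σ') (x' ν + σ') with hI'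
    set P := Fintype.piFinset (Function.update (fun i => Finset.Icc (x i - σ) (x i + σ)) ν {x ν}) with hP
    -- split the box sum along the coordinate `ν`
    have hsplit := sum_box_eq_sum_update (α := ℝ) x σ ν (x ν) (fun y => if y ν ∉ I' then f y else 0)
    rw [hQ]
    rw [hsplit]
    -- the summand after pinning: the indicator depends on `s` only
    have hupd : ∀ s ∈ I, ∀ y ∈ P, (if (Function.update y ν s) ν ∉ I' then f (Function.update y ν s) else 0) =
        (if s ∉ I' then f (Function.update y ν s) else 0) := by
      intro s _ y _; rw [Function.update_self]
    rw [Finset.sum_congr rfl fun s hs => Finset.sum_congr rfl fun y hy => hupd s hs y hy]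
    -- keep only the extreme abscissae
    have hkeep : ∑ s ∈ I, ∑ y ∈ P, (if s ∉ I' then f (Function.update y ν s) else 0) =
        ∑ s ∈ I \ I', ∑ y ∈ P, f (Function.update y ν s) := by
      rw [← Finset.sum_sdiff (Finset.sdiff_subset : I \ I' ⊆ I)]
      have hz : ∑ s ∈ I \ (I \ I'), ∑ y ∈ P, (if s ∉ I' then f (Function.update y ν s) else 0) = 0 := by
        refine Finset.sum_eq_zero fun s hs => ?_
        rw [Finset.mem_sdiff, Finset.mem_sdiff] at hs
        push Not at hs
        have hsI' : s ∈ I' := hs.2 hs.1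
        simp [hsI']
      rw [hz, zero_add]
      refine Finset.sum_congr rfl fun s hs => ?_
      rw [Finset.mem_sdiff] at hs
      simp [hs.2]
    rw [hkeep]
    -- every point of the pinned box with an abscissa in `I` lies in `Q`
    have hmemQ : ∀ s ∈ I, ∀ y ∈ P, Function.update y ν s ∈ box x σ := by
      intro s hs y hy
      rw [hP, Fintype.mem_piFinset] at hy
      rw [mem_box]; intro i
      by_cases hi : i = ν
      · subst hi; rw [Function.update_self]; rw [hI, Finset.mem_Icc] at hs; rw [abs_le]; constructor <;> linarith [hs.1, hs.2]
      · rw [Function.update_of_ne hi]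
        have := hy i
        rw [Function.update_of_ne hi, Finset.mem_Icc] at this
        rw [abs_le]; constructor <;> linarith [this.1, this.2]
    -- the per-point line bound, uniform in `s`
    have hline : ∀ s ∈ I \ I', ∑ y ∈ P, f (Function.update y ν s) ≤
        ∑ y ∈ P, (∑ t ∈ I, ‖u (Function.update y ν t + unitVec ν) - u (Function.update y ν t)‖ + n⁻¹ * ∑ t ∈ I, f (Function.update y ν t)) := by
      intro s hs
      rw [Finset.mem_sdiff] at hs
      refine Finset.sum_le_sum fun y hy => ?_
      have h := norm_sub_le_line u m x hσ0 ν (hmemQ s hs.1 y hy)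
      simp only [Function.update_idem] at h
      exact h
    -- re-assemble the pinned sums
    have hre : ∑ y ∈ P, (∑ t ∈ I, ‖u (Function.update y ν t + unitVec ν) - u (Function.update y ν t)‖ + n⁻¹ * ∑ t ∈ I, f (Function.update y ν t)) =
        ∑ y ∈ box x σ, ‖u (y + unitVec ν) - u y‖ + n⁻¹ * ∑ y ∈ box x σ, f y := by
      rw [Finset.sum_add_distrib, ← Finset.mul_sum]
      rw [hP, hI, sum_pinned_line_eq x σ ν (x ν) (fun y => ‖u (y + unitVec ν) - u y‖), sum_pinned_line_eq x σ ν (x ν) f]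
    have hcard2 : ((I \ I').card : ℝ) ≤ 2 := by exact_mod_cast card_Icc_sdiff_le_two hσ' hsub hσ ν
    calc ∑ s ∈ I \ I', ∑ y ∈ P, f (Function.update y ν s)
        ≤ ∑ _s ∈ I \ I', (∑ y ∈ box x σ, ‖u (y + unitVec ν) - u y‖ + n⁻¹ * ∑ y ∈ box x σ, f y) :=
          Finset.sum_le_sum fun s hs => (hline s hs).trans (le_of_eq hre)
      _ = ((I \ I').card : ℝ) * (∑ y ∈ box x σ, ‖u (y + unitVec ν) - u y‖ + n⁻¹ * ∑ y ∈ box x σ, f y) := by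
          rw [Finset.sum_const, nsmul_eq_mul]
      _ ≤ 2 * (∑ y ∈ box x σ, ‖u (y + unitVec ν) - u y‖ + n⁻¹ * ∑ y ∈ box x σ, f y) := by
          refine mul_le_mul_of_nonneg_right hcard2 (add_nonneg (Finset.sum_nonneg fun _ _ => norm_nonneg _) ?_)
          exact mul_nonneg (inv_pos.2 hn0).le (Finset.sum_nonneg fun y _ => hf0 y)
  -- (c) sum over directions and the mean-form Poincaré inequality
  have hP1 : ∑ y ∈ Q, f y ≤ 2 * n * G := by
    have := sum_norm_sub_mean_le u x hσ0
    rw [← hQ] at this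
    exact this
  have hdir : ∑ ν : Fin d, ∑ y ∈ Q, ‖u (y + unitVec ν) - u y‖ = G := by rw [hG, Finset.sum_comm]
  calc ∑ y ∈ Q \ box x' σ', f y
      ≤ ∑ ν : Fin d, ∑ y ∈ Q, (if y ν ∉ Finset.Icc (x' ν - σ') (x' ν + σ') then f y else 0) := hstep1
    _ ≤ ∑ ν : Fin d, 2 * (∑ y ∈ Q, ‖u (y + unitVec ν) - u y‖ + n⁻¹ * ∑ y ∈ Q, f y) := Finset.sum_le_sum fun ν _ => hstep2 ν
    _ = 2 * G + 2 * d * (n⁻¹ * ∑ y ∈ Q, f y) := by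
        rw [← Finset.mul_sum, Finset.sum_add_distrib, hdir, Finset.sum_const, Finset.card_univ, Fintype.card_fin, nsmul_eq_mul]; ring
    _ ≤ 2 * G + 2 * d * (n⁻¹ * (2 * n * G)) := by
        have h0 : 0 ≤ (n⁻¹ : ℝ) := (inv_pos.2 hn0).le
        nlinarith [mul_le_mul_of_nonneg_left hP1 h0, Nat.cast_nonneg (α := ℝ) d]
    _ = (2 + 4 * d) * G := by field_simp; ring

/-! ## §4 Sharp nested means -/

/-- ★★★ **SHARP NESTED-BOX MEANS**: `Q′ = Q_{σ′}(x′) ⊆ Q = Q_σ(x)`, `0 ≤ σ, σ′`, `σ ≤ σ′ + 1` ⟹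
`‖ū_Q − ū_{Q′}‖ ≤ (2 + 4d)·(#Q′)⁻¹·Σ_{y∈Q} Σ_μ ‖u(y+e_μ) − u(y)‖` — the lattice `|dū_r∕dr| ≤ C·avg|∇u|`, with NO factor `σ` (`#Q ≤ 3^d·#Q′`, so this is
`(2+4d)·3^d` times the `ℓ¹`-MEAN of `‖∇u‖` over `Q`). [folklore] [cite: SchoenUhlenbeck1982, §4 (variable-radius mollification)] -/
theorem norm_mean_sub_mean_le_of_nested (u : Zd d → V) {x x' : Zd d} {σ σ' : ℤ} (hσ0 : 0 ≤ σ) (hσ' : 0 ≤ σ') (hsub : box x' σ' ⊆ box x σ)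
    (hσ : σ ≤ σ' + 1) :
    ‖(((box x σ).card : ℝ))⁻¹ • ∑ y ∈ box x σ, u y - (((box x' σ').card : ℝ))⁻¹ • ∑ y ∈ box x' σ', u y‖ ≤
      (2 + 4 * d) * ((((box x' σ').card : ℝ))⁻¹ * ∑ y ∈ box x σ, ∑ μ, ‖u (y + unitVec μ) - u y‖) := by
  classical
  have hQ' : (box x' σ').Nonempty := ⟨x', self_mem_box x' hσ'⟩
  have hc : (0 : ℝ) ≤ (((box x' σ').card : ℝ))⁻¹ := by positivity
  have h1 := norm_mean_sub_mean_le_sum_sdiff hsub hQ' u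
  have h2 := sum_sdiff_norm_sub_mean_le u hσ0 hσ' hsub hσ
  calc _ ≤ _ := h1
    _ ≤ (((box x' σ').card : ℝ))⁻¹ * ((2 + 4 * d) * ∑ y ∈ box x σ, ∑ μ, ‖u (y + unitVec μ) - u y‖) := mul_le_mul_of_nonneg_left h2 hc
    _ = _ := by ring

omit [NormedSpace ℝ V] in
/-- `(Σ_{y∈Q} Σ_μ ‖g y μ‖)² ≤ d · #Q · Σ_{y∈Q} Σ_μ ‖g y μ‖²` (Cauchy–Schwarz; square of ✓`sum_sum_norm_le_sqrt`). [folklore] -/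
theorem sq_sum_sum_norm_le (Q : Finset (Zd d)) (g : Zd d → Fin d → V) :
    (∑ y ∈ Q, ∑ μ, ‖g y μ‖) ^ 2 ≤ d * Q.card * ∑ y ∈ Q, ∑ μ, ‖g y μ‖ ^ 2 := by
  have h := PoincareLipschitzSphereMapPoincareL1.sum_sum_norm_le_sqrt Q g
  have h0 : 0 ≤ ∑ y ∈ Q, ∑ μ, ‖g y μ‖ := Finset.sum_nonneg fun _ _ => Finset.sum_nonneg fun _ _ => norm_nonneg _
  have h1 : 0 ≤ (d : ℝ) * Q.card * ∑ y ∈ Q, ∑ μ, ‖g y μ‖ ^ 2 := by positivity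
  calc (∑ y ∈ Q, ∑ μ, ‖g y μ‖) ^ 2 ≤ (Real.sqrt (d * Q.card * ∑ y ∈ Q, ∑ μ, ‖g y μ‖ ^ 2)) ^ 2 := pow_le_pow_left₀ h0 h 2
    _ = _ := Real.sq_sqrt h1

/-- ★★ **SQUARED FORM**: under the hypotheses of `norm_mean_sub_mean_le_of_nested`,
`‖ū_Q − ū_{Q′}‖² ≤ (2 + 4d)²·(d·#Q·(#Q′)⁻²)·Σ_{y∈Q} Σ_μ ‖u(y+e_μ) − u(y)‖²` — with `#Q ≤ 3^d·#Q′`, `(2+4d)²·d·3^{2d}` times the MEAN of `‖∇u‖²` over `Q`: the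
per-bond letter of the variable-radius mollifier (E→R F4). [folklore] [cite: SchoenUhlenbeck1982, §4] -/
theorem normSq_mean_sub_mean_le_of_nested (u : Zd d → V) {x x' : Zd d} {σ σ' : ℤ} (hσ0 : 0 ≤ σ) (hσ' : 0 ≤ σ') (hsub : box x' σ' ⊆ box x σ)
    (hσ : σ ≤ σ' + 1) :
    ‖(((box x σ).card : ℝ))⁻¹ • ∑ y ∈ box x σ, u y - (((box x' σ').card : ℝ))⁻¹ • ∑ y ∈ box x' σ', u y‖ ^ 2 ≤
      (2 + 4 * d) ^ 2 * (d * (box x σ).card * ((((box x' σ').card : ℝ))⁻¹) ^ 2) * ∑ y ∈ box x σ, ∑ μ, ‖u (y + unitVec μ) - u y‖ ^ 2 := by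
  have h1 := norm_mean_sub_mean_le_of_nested u hσ0 hσ' hsub hσ
  have h2 := sq_sum_sum_norm_le (box x σ) (fun y μ => u (y + unitVec μ) - u y)
  have hP : 0 ≤ ‖(((box x σ).card : ℝ))⁻¹ • ∑ y ∈ box x σ, u y - (((box x' σ').card : ℝ))⁻¹ • ∑ y ∈ box x' σ', u y‖ := norm_nonneg _
  have h3 := pow_le_pow_left₀ hP h1 2
  have hc : 0 ≤ ((((box x' σ').card : ℝ))⁻¹) ^ 2 := sq_nonneg _
  have hd4 : 0 ≤ (2 + 4 * (d : ℝ)) ^ 2 := sq_nonneg _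
  calc _ ≤ ((2 + 4 * d) * ((((box x' σ').card : ℝ))⁻¹ * ∑ y ∈ box x σ, ∑ μ, ‖u (y + unitVec μ) - u y‖)) ^ 2 := h3
    _ = (2 + 4 * d) ^ 2 * ((((box x' σ').card : ℝ))⁻¹) ^ 2 * (∑ y ∈ box x σ, ∑ μ, ‖u (y + unitVec μ) - u y‖) ^ 2 := by ring
    _ ≤ (2 + 4 * d) ^ 2 * ((((box x' σ').card : ℝ))⁻¹) ^ 2 * (d * (box x σ).card * ∑ y ∈ box x σ, ∑ μ, ‖u (y + unitVec μ) - u y‖ ^ 2) :=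
        mul_le_mul_of_nonneg_left h2 (mul_nonneg hd4 hc)
    _ = _ := by ring

end Summit.QuantumFields.YangMills.Theorems.PoincareLipschitzSphereMapNestedMeans
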